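import Mathlib
import Summits.Ventures.PercRepro2.Defs
import Summits.Ventures.PercRepro2.Graph
import Summits.Ventures.PercRepro2.OneColourSwitch
import Summits.Ventures.PercRepro2.RegionHubSign
import Summits.Ventures.PercRepro2.SideSwitch
import Summits.Ventures.PercRepro2.M9NoPocketDefs
import Summits.Ventures.PercRepro2.M9DAvoid

/-!
# The `d`-avoiding split of the single-`d` sum (blind cell PercRepro2, p3 g22, 2026-08-28)

`proofs/P3-CPNC.md` §19g (1) at the level of the whole single-`d` family: with
`σ̃_pq := sigma (endsD ends d) ω p q` (the colour preference of `p, q` in `G − d`) and the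
`W`-hub defect `eW ω := 1[p ~_W q] − 1[p ~_W q in G − d] ≥ 0`,

  `dSignSum = Σ_{Sep ∧ DOne} σ̃_pq · σ_rs − 2 · Σ_{Sep ∧ DOne, d ∉ M₂} eW · σ_rs`.

Pointwise (`sigma_eq_endsD_add`): `σ_pq = σ̃_pq + [d ∉ K₂] eY − [d ∉ M₂] eW`, because the `Y`-
(resp. `W`-) connection of `p` agrees with the one of `G − d` as soon as `d` lies in the
`Y`- (resp. `W`-) world of `{r, s}` (`M9DAvoid`); the `eY`-term is the colour flip of the
`eW`-term (`sum_eY_eq_neg_sum_eW`: `Sep ∧ DOne` is flip-invariant and `σ_rs` flips sign), which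
gives the factor `2`.  On the groups of §19h (no unreached `d`) the second sum is the term
`T2 ≥ 0` of the proof; the first is `T1`.  Own work, one seat.
-/

namespace Summit.Ventures.PercRepro2

namespace NoPocket

open Finset Classical RegionHub OneColourSwitch SideSwitch

variable {V : Type*} {E : Type*}
variable [Fintype E] [DecidableEq E]
variable (ends : E → Sym2 V)

/-- The `Y`-hub defect of `d` for the pair `p, q`: `1[p ~_Y q] − 1[p ~_Y q in G − d]`. -/
noncomputable def eY (d p q : V) (ω : Config E) : ℤ :=
  (if Conn ends ω p q then 1 else 0) - (if Conn (endsD ends d) ω p q then 1 else 0)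

/-- The `W`-hub defect of `d` for the pair `p, q`. -/
noncomputable def eW (d p q : V) (ω : Config E) : ℤ :=
  eY ends d p q (OneColourSwitch.compl ω)

variable {ends}

omit [Fintype E] [DecidableEq E] in
/-- The `W`-defect of the flipped colouring is the `Y`-defect. -/
lemma eW_compl {d p q : V} (ω : Config E) :
    eW ends d p q (OneColourSwitch.compl ω) = eY ends d p q ω := by
  simp only [eW, compl_compl]

omit [Fintype E] [DecidableEq E] in
/-- The `Y`-defect is non-negative (`G − d` has fewer open paths). -/
lemma eY_nonneg {d p q : V} (ω : Config E) : 0 ≤ eY ends d p q ω := by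
  unfold eY
  by_cases h : Conn (endsD ends d) ω p q
  · simp [h, conn_of_conn_endsD h]
  · simp only [h, if_false, sub_zero]
    split_ifs <;> norm_num

omit [Fintype E] [DecidableEq E] in
/-- The `W`-defect is non-negative. -/
lemma eW_nonneg {d p q : V} (ω : Config E) : 0 ≤ eW ends d p q ω :=
  eY_nonneg (ends := ends) (d := d) (p := p) (q := q) (OneColourSwitch.compl ω)

omit [Fintype E] [DecidableEq E] in
/-- The `Y`-defect vanishes when `d` lies in the `Y`-world and `p` does not. -/
lemma eY_eq_zero_of_mem_K2 {d p q r s : V} {ω : Config E} (hp : p ∉ K2 ends r s ω)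
    (hd : d ∈ K2 ends r s ω) : eY ends d p q ω = 0 := by
  simp only [eY, conn_endsD_iff_of_mem_K2 hp hd, sub_self]

omit [Fintype E] [DecidableEq E] in
/-- The `W`-defect vanishes when `d` lies in the `W`-world and `p` does not. -/
lemma eW_eq_zero_of_mem_M2 {d p q r s : V} {ω : Config E} (hp : p ∉ M2 ends r s ω)
    (hd : d ∈ M2 ends r s ω) : eW ends d p q ω = 0 :=
  eY_eq_zero_of_mem_K2 (r := r) (s := s) (ω := OneColourSwitch.compl ω) hp hd

omit [Fintype E] [DecidableEq E] in
/-- **The pointwise split.** Under `sep2`,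
`σ_pq = σ̃_pq + [d ∉ K₂] · eY − [d ∉ M₂] · eW`. -/
lemma sigma_eq_endsD_add {d p q r s : V} {ω : Config E} (hsep : sep2 ends p q r s ω) :
    sigma ends ω p q = sigma (endsD ends d) ω p q
      + (if d ∈ K2 ends r s ω then 0 else eY ends d p q ω)
      - (if d ∈ M2 ends r s ω then 0 else eW ends d p q ω) := by
  obtain ⟨hpK, _⟩ := not_mem_K2_of_sep2 hsep
  obtain ⟨hpM, _⟩ := not_mem_M2_of_sep2 hsep
  have hY : (if d ∈ K2 ends r s ω then 0 else eY ends d p q ω) = eY ends d p q ω := by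
    split_ifs with h
    · exact (eY_eq_zero_of_mem_K2 hpK h).symm
    · rfl
  have hW : (if d ∈ M2 ends r s ω then 0 else eW ends d p q ω) = eW ends d p q ω := by
    split_ifs with h
    · exact (eW_eq_zero_of_mem_M2 hpM h).symm
    · rfl
  rw [hY, hW]
  simp only [sigma, eY, eW]
  ring

variable (ends)

/-- The `Y`-defect part of the single-`d` sum. -/
noncomputable def eYSum (p q r s d : V) : ℤ :=
  ∑ ω : Config E, if sep2 ends p q r s ω ∧ DOne ends r s d ω ∧ d ∉ K2 ends r s ω then
    eY ends d p q ω * sigma ends ω r s else 0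

/-- The `W`-defect part of the single-`d` sum (the term `T2` of §19h). -/
noncomputable def eWSum (p q r s d : V) : ℤ :=
  ∑ ω : Config E, if sep2 ends p q r s ω ∧ DOne ends r s d ω ∧ d ∉ M2 ends r s ω then
    eW ends d p q ω * sigma ends ω r s else 0

/-- The `d`-avoiding sign-form sum `Σ_{Sep ∧ DOne} σ̃_pq · σ_rs` (the term `T1` of §19h). -/
noncomputable def dSignSumAvoid (p q r s d : V) : ℤ :=
  ∑ ω : Config E, if sep2 ends p q r s ω ∧ DOne ends r s d ω then
    sigma (endsD ends d) ω p q * sigma ends ω r s else 0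

variable {ends}

/-- Reindexing a sum over configurations by the colour flip. -/
lemma sum_compl' (F : Config E → ℤ) : ∑ ω, F (OneColourSwitch.compl ω) = ∑ ω, F ω :=
  Equiv.sum_comp OneColourSwitch.complPerm F

omit [Fintype E] [DecidableEq E] in
/-- The colour flip negates `σ`. -/
lemma sigma_compl' (ω : Config E) (a b : V) :
    sigma ends (OneColourSwitch.compl ω) a b = - sigma ends ω a b := by
  simp only [sigma, compl_compl]
  ring

omit [Fintype E] [DecidableEq E] in
/-- `DOne` is invariant under the colour flip (both directions). -/
lemma DOne_compl_iff {r s d : V} {ω : Config E} :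
    DOne ends r s d (OneColourSwitch.compl ω) ↔ DOne ends r s d ω :=
  ⟨fun h => by simpa using DOne_compl h, fun h => DOne_compl h⟩

/-- **The two defect parts are opposite**: `eYSum = − eWSum` (flip every colouring). -/
lemma eYSum_eq_neg_eWSum (p q r s d : V) :
    eYSum ends p q r s d = - eWSum ends p q r s d := by
  unfold eYSum eWSum
  rw [← Finset.sum_neg_distrib]
  rw [← sum_compl' (fun ω => if sep2 ends p q r s ω ∧ DOne ends r s d ω ∧ d ∉ K2 ends r s ω then
    eY ends d p q ω * sigma ends ω r s else 0)]
  refine Finset.sum_congr rfl fun ω _ => ?_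
  simp only [sep2_compl, DOne_compl_iff, K2_compl, eY, eW, sigma_compl']
  split_ifs <;> ring

/-- **The `d`-avoiding split of the single-`d` sum**:
`dSignSum = dSignSumAvoid − 2 · eWSum`. -/
theorem dSignSum_eq_avoid_sub (p q r s d : V) :
    dSignSum ends p q r s d = dSignSumAvoid ends p q r s d - 2 * eWSum ends p q r s d := by
  have h1 : dSignSum ends p q r s d
      = dSignSumAvoid ends p q r s d + eYSum ends p q r s d - eWSum ends p q r s d := by
    unfold dSignSum dSignSumAvoid eYSum eWSum
    rw [← Finset.sum_add_distrib, ← Finset.sum_sub_distrib]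
    refine Finset.sum_congr rfl fun ω _ => ?_
    by_cases h : sep2 ends p q r s ω ∧ DOne ends r s d ω
    · have hs := sigma_eq_endsD_add (d := d) h.1
      simp only [h, and_true, true_and, if_true]
      rw [hs]
      by_cases hK : d ∈ K2 ends r s ω <;> by_cases hM : d ∈ M2 ends r s ω <;>
        simp [hK, hM] <;> ring
    · have h' : ¬ (sep2 ends p q r s ω ∧ DOne ends r s d ω ∧ d ∉ K2 ends r s ω) :=
        fun hh => h ⟨hh.1, hh.2.1⟩
      have h'' : ¬ (sep2 ends p q r s ω ∧ DOne ends r s d ω ∧ d ∉ M2 ends r s ω) :=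
        fun hh => h ⟨hh.1, hh.2.1⟩
      simp only [h, h', h'', if_false, add_zero, sub_zero]
  rw [h1, eYSum_eq_neg_eWSum]
  ring


omit [Fintype E] [DecidableEq E] in
/-- With an edge from `d` to `r`, `d ∉ M₂` forces that edge to be `Y`, so `r ~_Y d`. -/
lemma conn_of_edge_of_not_mem_M2 {d r s t : V} {ω : Config E} (hd : d ∉ M2 ends r s ω)
    (ht : t = r ∨ t = s) {e : E} (he : ends e = s(d, t)) : Conn ends ω d t := by
  by_cases hω : ω e = true
  · exact conn_of_openAdj ⟨e, hω, he⟩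
  · exfalso
    apply hd
    have hc : Conn ends (OneColourSwitch.compl ω) d t := by
      refine conn_of_openAdj ⟨e, ?_, he⟩
      simp only [OneColourSwitch.compl, Bool.not_eq_true']
      exact Bool.eq_false_iff.2 hω
    rcases ht with rfl | rfl
    · exact mem_M2_iff.2 (Or.inl (conn_symm hc))
    · exact mem_M2_iff.2 (Or.inr (conn_symm hc))

/-- **`T2 ≥ 0` when `d` touches both terminals**: with edges `d–r` and `d–s`, on every
colouring with `d ∉ M₂` the pair `r, s` is `Y`-connected through `d`, so `σ_rs ≥ 0` there and the
`W`-defect sum is non-negative. -/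
theorem eWSum_nonneg_of_edges (p q r s d : V) {er es : E} (hr : ends er = s(d, r))
    (hs : ends es = s(d, s)) : 0 ≤ eWSum ends p q r s d := by
  unfold eWSum
  refine Finset.sum_nonneg fun ω _ => ?_
  split_ifs with h
  · obtain ⟨_, _, hM⟩ := h
    have h1 : Conn ends ω d r := conn_of_edge_of_not_mem_M2 hM (Or.inl rfl) hr
    have h2 : Conn ends ω d s := conn_of_edge_of_not_mem_M2 hM (Or.inr rfl) hs
    have hrs : Conn ends ω r s := conn_trans (conn_symm h1) h2
    have hσ : 0 ≤ sigma ends ω r s := by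
      simp only [sigma, hrs, if_true]
      split_ifs <;> norm_num
    exact mul_nonneg (eW_nonneg ω) hσ
  · exact le_refl 0

end NoPocket

end Summit.Ventures.PercRepro2
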